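import Literature.Geometry.Lorentzian.CoordCurvatureRicciIdentity
import HarnessLib

/-!
# Evolution of the Ricci tensor under the Ricci flow, in coordinates (Hamilton 1982, Cor. 7.3)

Sixth layer of the coordinate tensor calculus (`CoordCurvature`, `CoordBianchi`,
`CoordMetricVariation`, `CoordScalarCurvatureEvolution`, `CoordCurvatureRicciIdentity`). For a
smooth one-parameter family of metric components `G : ℝ → E → (E →L E →L ℝ)` on `V × S`
(`IsMetricFamilyOn G S V`) satisfying the **Ricci flow in coordinates** `∂G/∂t = −2 Ric(G)` we
prove that at every `t ∈ S`, `x ∈ V` and for all `Y, Z ∈ E` the Ricci form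
`s ↦ Ric(G s)_x(Y, Z)` is differentiable within `S` with derivative

  `ΔRic(Y,Z) + Σ_{ij} g^{ij} [Ric(R(bᵢ,Y)Z, bⱼ) + Ric(R(bᵢ,Z)Y, bⱼ) + Ric(Z, R(bᵢ,Y)bⱼ) + Ric(Y, R(bᵢ,Z)bⱼ)]`

(`IsMetricFamilyOn.hasDerivWithinAt_ricAt_ricciFlow`; `Δ` the rough Laplacian `lapBilinAt`
defined here, `R = riemAt`, any basis `b` with inverse metric coefficients `g^{ij}`), and then
bring the reaction term to the printed form (`hasDerivWithinAt_ricAt_ricciFlow'`):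

  `∂_t Ric(Y,Z) = ΔRic(Y,Z) + 2 Σ_{ij} g^{ij} Ric(R(bᵢ,Y)Z, bⱼ) − 2 Σ_{kl} g^{kl} Ric(Y,b_k) Ric(Z,b_l)`,

which is **Hamilton 1982, Cor. 7.3**: `∂_t R_{ik} = ΔR_{ik} + 2 g^{pr} g^{qs} R_{piqk} R_{rs} − 2 g^{pq} R_{pi} R_{qk}`
(Topping 2006, Prop. 2.5.3 / (2.5.4): `∂_t Ric = Δ_L Ric`, i.e.
`∂_t Ric(X,W) = ΔRic(X,W) − 2⟨Ric(X),Ric(W)⟩ + 2⟨Rm(X,·,W,·),Ric⟩`), in the sign convention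
`R(X,Y) = [∇_X,∇_Y]` of `riemAt` (`Ric(Y,Z) = tr (X ↦ R(X,Y)Z)`). On the way:

* `lapBilinAt G β x (Y, Z) = tr_G ∇²β(·,·;Y,Z) = Σ_{kl} g^{kl} ∇²β(b_k, b_l; Y, Z)` — the **rough
  (connection) Laplacian** of a field of bilinear forms (Topping 2006, §2.1: "`Δ` the connection
  Laplacian `tr ∇²`"; Hamilton 1982, §7: `ΔR_{ik} = g^{pq} ∇_p ∇_q R_{ik}`), defined through the
  metric trace `mtrAt` (basis independent), with the basis formula `lapBilinAt_apply_eq_sum` and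
  its symmetry on symmetric fields;
* `IsMetricOn.sum_ginv_cov₃At_cov₂At_ricAt` — `Σ g^{ij} ∇²Ric(Y,bᵢ;Z,bⱼ) = ½ Hess S(Y,Z)` (the
  covariant derivative of the contracted Bianchi identity `div Ric = ½ dS`);
* `IsMetricOn.sum_ginv_ricAt_riemAt` — `Σ g^{ij} Ric(Z, R(bᵢ,Y)bⱼ) = −⟨Ric(Y), Ric(Z)⟩`, and
  `IsMetricOn.sum_ginv_ricAt_riemAt_comm` — the symmetry in `Y, Z` of `Σ g^{ij} Ric(R(bᵢ,Y)Z, bⱼ)`.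

## Proof (Hamilton 1982, §7 / Topping 2006, Prop. 2.3.7 route, on constant fields)

By `CoordMetricVariation` (Topping, Prop. 2.3.4), `∂_t Ric(Y,Z) = Σᵢ bⁱ((∂_t R)(bᵢ,Y)Z)` with
`∂_t R(X,Y) = (∇_XΠ)(Y,·) − (∇_YΠ)(X,·)`, `Π = ∂_tΓ`. The second trace is `−Hess S(Y,Z)`:
`trₓ Π(·,Z) = −dS(Z)` under the flow (`sum_coord_varChrAt_eq`, from Prop. 2.3.1 with
`h = −2Ric` and the contracted Bianchi identity), so `Σᵢ bⁱ((∇_YΠ)(bᵢ,Z)) = −(∇_Y dS)(Z)`. The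
first trace is computed through the metric: `bⁱ(v) = Σⱼ g^{ij} G(v, bⱼ)`, lowering commutes with
`∇` (`apply_cov_varChrAt`), and by Prop. 2.3.1 under the flow `G(Π(X,Y),U) = −[(∇Ric)(X;Y,U) +
(∇Ric)(Y;X,U) − (∇Ric)(U;X,Y)]`, whence

  `Σᵢ bⁱ((∇_{bᵢ}Π)(Y,Z)) = ΔRic(Y,Z) − Σ g^{ij} ∇²Ric(bᵢ,Y;Z,bⱼ) − Σ g^{ij} ∇²Ric(bᵢ,Z;Y,bⱼ)`.

Commuting the covariant derivatives (the Ricci identity, `CoordCurvatureRicciIdentity`) turns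
`Σ g^{ij}∇²Ric(bᵢ,Y;Z,bⱼ)` into `Σ g^{ij}∇²Ric(Y,bᵢ;Z,bⱼ) − Σ g^{ij}[Ric(R(bᵢ,Y)Z,bⱼ) + Ric(Z,R(bᵢ,Y)bⱼ)]`,
and `Σ g^{ij}∇²Ric(Y,bᵢ;Z,bⱼ) = (∇_Y div Ric)(Z) = ½ Hess S(Y,Z)` by the contracted Bianchi identity
`div Ric = ½ dS` (`CoordBianchi.fderiv_scalAt`) and "traces commute with `∇`"
(`CoordBianchi.fderiv_mtrAt`). The three Hessians of `S` cancel by the symmetry of `Hess S`.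
The printed form follows from `Σ g^{ij} R(bᵢ,Y)bⱼ = −♯Ric(Y,·)` and the pair symmetry of the
curvature tensor. Everything is proved; no definition of `Prop` type is introduced. This is the
parabolic input of the energy argument (Kotschwar 2014) for
`Literature.Geometry.Riemannian.ricciFlow_uniqueness`.

## References

* R. S. Hamilton, *Three-manifolds with positive Ricci curvature*, J. Differential Geom. 17
  (1982), §7, Thm. 7.1, Lemma 7.2, Cor. 7.3 (p. 275). [Hamilton1982]
* P. Topping, *Lectures on the Ricci flow*, LMS Lecture Note Series 325, CUP 2006, §2.1,
  Prop. 2.3.1, 2.3.4, 2.3.7, §2.5, Prop. 2.5.3, (2.5.3)–(2.5.4) (p. 33). [Topping2006]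
* B. O'Neill, *Semi-Riemannian geometry with applications to relativity*, 1983, Ch. 3,
  Lemma 3.49 (Hessian), Cor. 3.54, p. 86. [ONeill1983]
* B. Kotschwar, *An energy approach to the problem of uniqueness for the Ricci flow*,
  Comm. Anal. Geom. 22 (2014), §1.1. [Kotschwar2014]
-/

noncomputable section

set_option maxSynthPendingDepth 3

open Set Filter ContinuousLinearMap Module
open scoped Topology ContDiff

namespace Literature.Geometry.Lorentzian

namespace MetricCoord

variable {E : Type*} [NormedAddCommGroup E] [NormedSpace ℝ E]

/-! ### Smoothness of `∇β` -/

section Smooth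

variable [CompleteSpace E] {G : E → E →L[ℝ] E →L[ℝ] ℝ} {V : Set E} {x : E}
  {β : E → E →L[ℝ] E →L[ℝ] ℝ}

omit [CompleteSpace E] in
/-- Pointwise form of `cov₂At` as a combination of smooth operations (for smoothness statements).
[folklore] -/
theorem cov₂At_eq (G : E → E →L[ℝ] E →L[ℝ] ℝ) (β : E → E →L[ℝ] E →L[ℝ] ℝ) :
    cov₂At G β = fun y ↦ fderiv ℝ β y
      - (ContinuousLinearMap.compL ℝ E E (E →L[ℝ] ℝ) (β y)).comp (chrAt G y)
      - flipCLM.comp ((ContinuousLinearMap.compL ℝ E E (E →L[ℝ] ℝ) (β y).flip).comp (chrAt G y)) :=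
  rfl

/-- **`∇β` is `C^∞` on `V` when `β` is.** [folklore] -/
theorem IsMetricOn.contDiffOn_cov₂At (hG : IsMetricOn G V) (hβ : ContDiffOn ℝ ∞ β V) :
    ContDiffOn ℝ ∞ (cov₂At G β) V := by
  have hβ2 : ContDiffOn ℝ ∞ (fderiv ℝ β) V := hβ.fderiv_of_isOpen hG.isOpen (by simp)
  have hΓ := hG.contDiffOn_chrAt
  have hA : ContDiffOn ℝ ∞
      (fun y ↦ (ContinuousLinearMap.compL ℝ E E (E →L[ℝ] ℝ) (β y)).comp (chrAt G y)) V :=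
    ((ContinuousLinearMap.compL ℝ E E (E →L[ℝ] ℝ)).contDiff.comp_contDiffOn hβ).clm_comp hΓ
  have hflip : ContDiffOn ℝ ∞ (fun y ↦ (β y).flip) V :=
    (ContinuousLinearMap.flipₗᵢ ℝ E E ℝ).contDiff.comp_contDiffOn hβ
  have hB : ContDiffOn ℝ ∞
      (fun y ↦ flipCLM.comp ((ContinuousLinearMap.compL ℝ E E (E →L[ℝ] ℝ) (β y).flip).comp
        (chrAt G y))) V :=
    contDiffOn_const.clm_comp
      (((ContinuousLinearMap.compL ℝ E E (E →L[ℝ] ℝ)).contDiff.comp_contDiffOn hflip).clm_comp hΓ)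
  rw [cov₂At_eq]
  exact (hβ2.sub hA).sub hB

/-- `∇β` is `C^∞` at the points of `V` when `β` is `C^∞` on `V`. [folklore] -/
theorem IsMetricOn.contDiffAt_cov₂At (hG : IsMetricOn G V) (hx : x ∈ V) (hβ : ContDiffOn ℝ ∞ β V) :
    ContDiffAt ℝ ∞ (cov₂At G β) x :=
  (hG.contDiffOn_cov₂At hβ x hx).contDiffAt (hG.mem_nhds hx)

/-- **`∇Ric` is `C^∞` on `V`.** [folklore] -/
theorem IsMetricOn.contDiffOn_cov₂At_ricAt [FiniteDimensional ℝ E] (hG : IsMetricOn G V) :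
    ContDiffOn ℝ ∞ (cov₂At G (ricAt G)) V :=
  hG.contDiffOn_cov₂At hG.contDiffOn_ricAt

end Smooth

/-! ### The rough Laplacian of a field of bilinear forms -/

section Laplacian

variable (G : E → E →L[ℝ] E →L[ℝ] ℝ) (β : E → E →L[ℝ] E →L[ℝ] ℝ)

/-- Evaluation of a trilinear form in its last two slots, `T ↦ (X ↦ T X Y Z)`, as a continuous
linear operator. [folklore] -/
def eval₂₃ (Y Z : E) : (E →L[ℝ] E →L[ℝ] E →L[ℝ] ℝ) →L[ℝ] (E →L[ℝ] ℝ) :=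
  ContinuousLinearMap.compL ℝ E (E →L[ℝ] E →L[ℝ] ℝ) ℝ
    ((ContinuousLinearMap.apply ℝ ℝ Z).comp (ContinuousLinearMap.apply ℝ (E →L[ℝ] ℝ) Y))

/-- Unfolding lemma for `eval₂₃`. [folklore] -/
@[simp]
theorem eval₂₃_apply (Y Z : E) (T : E →L[ℝ] E →L[ℝ] E →L[ℝ] ℝ) (X : E) :
    eval₂₃ Y Z T X = T X Y Z := rfl

/-- The bilinear form `(W, X) ↦ ∇²β(W, X; Y, Z)` whose metric trace is the rough Laplacian.
[folklore] -/
def hess₂At (x Y Z : E) : E →L[ℝ] E →L[ℝ] ℝ :=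
  (eval₂₃ Y Z).comp (cov₃At G (cov₂At G β) x)

/-- Unfolding lemma: `hess₂At G β x Y Z W X = ∇²β(W,X;Y,Z)`. [folklore] -/
@[simp]
theorem hess₂At_apply (x Y Z W X : E) :
    hess₂At G β x Y Z W X = cov₃At G (cov₂At G β) x W X Y Z := rfl

/-- `hess₂At` is additive in `Y`. [folklore] -/
theorem hess₂At_add_left (x Y₁ Y₂ Z : E) :
    hess₂At G β x (Y₁ + Y₂) Z = hess₂At G β x Y₁ Z + hess₂At G β x Y₂ Z := by
  ext W X; simp [map_add]

/-- `hess₂At` is homogeneous in `Y`. [folklore] -/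
theorem hess₂At_smul_left (x : E) (c : ℝ) (Y Z : E) :
    hess₂At G β x (c • Y) Z = c • hess₂At G β x Y Z := by
  ext W X; simp [map_smul]

/-- `hess₂At` is additive in `Z`. [folklore] -/
theorem hess₂At_add_right (x Y Z₁ Z₂ : E) :
    hess₂At G β x Y (Z₁ + Z₂) = hess₂At G β x Y Z₁ + hess₂At G β x Y Z₂ := by
  ext W X; simp [map_add]

/-- `hess₂At` is homogeneous in `Z`. [folklore] -/
theorem hess₂At_smul_right (x : E) (c : ℝ) (Y Z : E) :
    hess₂At G β x Y (c • Z) = c • hess₂At G β x Y Z := by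
  ext W X; simp [map_smul]

variable [FiniteDimensional ℝ E]

/-- The rough Laplacian as a bare function `(Y, Z) ↦ tr_G ∇²β(·,·;Y,Z)`; prefer the bundled
`lapBilinAt`. [cite: Topping2006, §2.1] -/
def lapBilinFun (x Y Z : E) : ℝ :=
  mtrAt G x (hess₂At G β x Y Z)

/-- The **rough (connection) Laplacian of a field of bilinear forms** for the components `G` at
`x`, as a bilinear map: `Δβ (Y, Z) = tr_G ∇²β(·, ·; Y, Z) = g^{kl} ∇_k ∇_l β(Y,Z)`
(Topping 2006, §2.1: "`Δ` denotes the connection (rough) Laplacian `tr₁₂ ∇²`"; Hamilton 1982,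
§7, p. 275: `ΔR_{ik} = g^{pq} ∇_p∇_q R_{ik}`). Defined through the metric trace `mtrAt`, hence
independent of any basis; the basis formula is `lapBilinAt_apply_eq_sum`.
[cite: Topping2006, §2.1] -/
def lapBilinAt (x : E) : E →L[ℝ] E →L[ℝ] ℝ :=
  mkCLM₂ (lapBilinFun G β x)
    (fun Y₁ Y₂ Z ↦ by simp only [lapBilinFun, hess₂At_add_left, mtrAt_add])
    (fun c Y Z ↦ by simp only [lapBilinFun, hess₂At_smul_left, mtrAt_smul])
    (fun Y Z₁ Z₂ ↦ by simp only [lapBilinFun, hess₂At_add_right, mtrAt_add])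
    (fun c Y Z ↦ by simp only [lapBilinFun, hess₂At_smul_right, mtrAt_smul])

/-- Unfolding lemma: `Δβ(Y,Z) = tr_G (hess₂At G β x Y Z)`. [cite: Topping2006, §2.1] -/
theorem lapBilinAt_apply (x Y Z : E) :
    lapBilinAt G β x Y Z = mtrAt G x (hess₂At G β x Y Z) := rfl

/-- **The rough Laplacian in a basis**: `Δβ(Y,Z) = Σ_{kl} g^{kl} ∇²β(b_k, b_l; Y, Z)`
(Hamilton 1982, §7: `ΔR_{ik} = g^{pq}∇_p∇_q R_{ik}`). [cite: Hamilton1982, §7] -/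
theorem lapBilinAt_apply_eq_sum {ι : Type*} [Fintype ι] (b : Basis ι ℝ E) (x Y Z : E) :
    lapBilinAt G β x Y Z = ∑ k, ∑ l, ginv G b x k l * cov₃At G (cov₂At G β) x (b k) (b l) Y Z := by
  rw [lapBilinAt_apply, mtrAt_eq_sum b]
  rfl

variable {G β} {V : Set E} {x : E} [CompleteSpace E]

/-- The rough Laplacian of a field of symmetric forms is symmetric:
`Δβ(Y,Z) = Δβ(Z,Y)` (each `∇²β(W,X;·,·)` is symmetric). [folklore] -/
theorem IsMetricOn.lapBilinAt_comm (hG : IsMetricOn G V) (hx : x ∈ V) (hβ : ContDiffOn ℝ ∞ β V)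
    (hs : ∀ y ∈ V, ∀ v w, β y v w = β y w v) (Y Z : E) :
    lapBilinAt G β x Y Z = lapBilinAt G β x Z Y := by
  set b := Module.finBasis ℝ E
  -- `∇β(W;·,·)` is symmetric on `V`, hence so is `∇²β(W,X;·,·)` at `x`
  have hβd : ∀ y ∈ V, DifferentiableAt ℝ β y := fun y hy ↦
    ((hβ y hy).contDiffAt (hG.mem_nhds hy)).differentiableAt (by simp)
  have h2 : ∀ y ∈ V, ∀ W v w, cov₂At G β y W v w = cov₂At G β y W w v := by
    intro y hy W v w
    simp only [cov₂At_apply]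
    have hd := hβd y hy
    have hvw : fderiv ℝ β y W v w = fderiv ℝ β y W w v := by
      rw [← fderiv_clm_apply_const hd v W, ← fderiv_clm_apply_const hd w W,
        ← fderiv_clm_apply_const (differentiableAt_clm_apply_const hd v) w W,
        ← fderiv_clm_apply_const (differentiableAt_clm_apply_const hd w) v W]
      have heq : (fun z ↦ β z v w) =ᶠ[𝓝 y] fun z ↦ β z w v :=
        (hG.eventually_mem hy).mono fun z hz ↦ hs z hz v w
      rw [heq.fderiv_eq]
    rw [hvw, hs y hy (chrAt G y W v) w, hs y hy v (chrAt G y W w)]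
    ring
  have hCd : DifferentiableAt ℝ (cov₂At G β) x :=
    hG.differentiableAt_cov₂At hx ((hβ x hx).contDiffAt (hG.mem_nhds hx))
  have h3 : ∀ W X, cov₃At G (cov₂At G β) x W X Y Z = cov₃At G (cov₂At G β) x W X Z Y := by
    intro W X
    simp only [cov₃At_apply]
    have hD : fderiv ℝ (cov₂At G β) x W X Y Z = fderiv ℝ (cov₂At G β) x W X Z Y := by
      have hdX := differentiableAt_clm_apply_const hCd X
      rw [← fderiv_clm_apply_const hCd X W, ← fderiv_clm_apply_const hdX Y W,
        ← fderiv_clm_apply_const hdX Z W,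
        ← fderiv_clm_apply_const (differentiableAt_clm_apply_const hdX Y) Z W,
        ← fderiv_clm_apply_const (differentiableAt_clm_apply_const hdX Z) Y W]
      have heq : (fun z ↦ cov₂At G β z X Y Z) =ᶠ[𝓝 x] fun z ↦ cov₂At G β z X Z Y :=
        (hG.eventually_mem hx).mono fun z hz ↦ h2 z hz X Y Z
      rw [heq.fderiv_eq]
    rw [hD, h2 x hx (chrAt G x W X) Y Z, h2 x hx X (chrAt G x W Y) Z, h2 x hx X Y (chrAt G x W Z),
      h2 x hx X (chrAt G x W Z) Y]
    ring
  rw [lapBilinAt_apply_eq_sum G β b, lapBilinAt_apply_eq_sum G β b]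
  exact Finset.sum_congr rfl fun k _ ↦ Finset.sum_congr rfl fun l _ ↦ by rw [h3]

end Laplacian

/-! ### Static identities: `∇ div Ric = ½ Hess S`, `tr_G Ric(Z, R(·,Y)·) = −⟨Ric(Y),Ric(Z)⟩` -/

section Static

variable {ι : Type*} [Fintype ι] [FiniteDimensional ℝ E] [CompleteSpace E]
  {G : E → E →L[ℝ] E →L[ℝ] ℝ} {V : Set E} {x : E} (b : Basis ι ℝ E)

/-- The field of bilinear forms `(U, W) ↦ (∇_U Ric)(Z, W)` (middle slot frozen), whose metric
trace is the divergence `div Ric (Z) = ½ dS(Z)`. [folklore] -/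
def divRicForm (G : E → E →L[ℝ] E →L[ℝ] ℝ) (Z : E) (y : E) : E →L[ℝ] E →L[ℝ] ℝ :=
  ContinuousLinearMap.compL ℝ E (E →L[ℝ] E →L[ℝ] ℝ) (E →L[ℝ] ℝ)
    (ContinuousLinearMap.apply ℝ (E →L[ℝ] ℝ) Z) (cov₂At G (ricAt G) y)

omit [CompleteSpace E] in
/-- Unfolding lemma: `divRicForm G Z y U W = (∇_U Ric)(Z, W)`. [folklore] -/
@[simp]
theorem divRicForm_apply (G : E → E →L[ℝ] E →L[ℝ] ℝ) (Z y U W : E) :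
    divRicForm G Z y U W = cov₂At G (ricAt G) y U Z W := by
  simp [divRicForm]

/-- **The contracted Bianchi identity as `div Ric = ½ dS`**: `Σ_{kl} g^{kl} (∇_{b_k} Ric)(Z, b_l) = ½ ∂_Z S`
on `V`. [cite: ONeill1983, Ch. 3, Cor. 3.54] -/
theorem IsMetricOn.mtrAt_divRicForm (hG : IsMetricOn G V) {y : E} (hy : y ∈ V) (Z : E) :
    mtrAt G y (divRicForm G Z y) = 2⁻¹ * fderiv ℝ (scalAt G) y Z := by
  set b' := Module.finBasis ℝ E
  rw [mtrAt_eq_sum b', hG.fderiv_scalAt b' hy Z]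
  simp only [divRicForm_apply]
  ring

/-- **`Σ g^{ij} ∇²Ric(Y, bᵢ; Z, bⱼ) = ½ Hess S(Y, Z)`**: the covariant derivative of
`div Ric = ½ dS` along `Y`, traces commuting with `∇` (O'Neill 1983, Ch. 3, p. 86) and
`Hess S(Y,Z) = D²S(Y,Z) − dS(Γ(Y,Z))`. [cite: ONeill1983, Ch. 3, Cor. 3.54] -/
theorem IsMetricOn.sum_ginv_cov₃At_cov₂At_ricAt (hG : IsMetricOn G V) (hx : x ∈ V) (Y Z : E) :
    ∑ i, ∑ j, ginv G b x i j * cov₃At G (cov₂At G (ricAt G)) x Y (b i) Z (b j) =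
      2⁻¹ * hessAt G (scalAt G) x Y Z := by
  have hC : ContDiffOn ℝ ∞ (cov₂At G (ricAt G)) V := hG.contDiffOn_cov₂At_ricAt
  have hCx : ContDiffAt ℝ ∞ (cov₂At G (ricAt G)) x := (hC x hx).contDiffAt (hG.mem_nhds hx)
  have hCd : DifferentiableAt ℝ (cov₂At G (ricAt G)) x := hCx.differentiableAt (by simp)
  -- the field `divRicForm G Z` is differentiable at `x`, with the obvious derivative
  set L := ContinuousLinearMap.compL ℝ E (E →L[ℝ] E →L[ℝ] ℝ) (E →L[ℝ] ℝ)
    (ContinuousLinearMap.apply ℝ (E →L[ℝ] ℝ) Z) with hL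
  have hβ : HasFDerivAt (divRicForm G Z) (L.comp (fderiv ℝ (cov₂At G (ricAt G)) x)) x :=
    (L.hasFDerivAt.comp x hCd.hasFDerivAt :)
  have hDβ : ∀ U W, fderiv ℝ (divRicForm G Z) x Y U W = fderiv ℝ (cov₂At G (ricAt G)) x Y U Z W := by
    intro U W; rw [hβ.fderiv]; rfl
  -- differentiate `tr_G (divRicForm G Z) = ½ dS(Z)` along `Y`
  have heq : (fun y ↦ mtrAt G y (divRicForm G Z y)) =ᶠ[𝓝 x] fun y ↦ 2⁻¹ * fderiv ℝ (scalAt G) y Z :=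
    (hG.eventually_mem hx).mono fun y hy ↦ hG.mtrAt_divRicForm hy Z
  have hS : ContDiffAt ℝ ∞ (scalAt G) x := hG.contDiffAt_scalAt hx
  have hdS : DifferentiableAt ℝ (fderiv ℝ (scalAt G)) x :=
    (hS.fderiv_right (m := ∞) (by simp)).differentiableAt (by simp)
  have hder : fderiv ℝ (fun y ↦ mtrAt G y (divRicForm G Z y)) x Y =
      2⁻¹ * fderiv ℝ (fderiv ℝ (scalAt G)) x Y Z := by
    rw [heq.fderiv_eq, fderiv_const_mul (differentiableAt_clm_apply_const hdS Z),
      _root_.smul_apply, fderiv_clm_apply_const hdS Z Y, smul_eq_mul]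
  rw [hG.fderiv_mtrAt hx hβ.differentiableAt Y, mtrAt_eq_sum b] at hder
  simp only [cov₂At_apply G (divRicForm G Z), hDβ, divRicForm_apply] at hder
  -- compare with the expansion of `∇²Ric(Y, bᵢ; Z, bⱼ)`
  have hdiv := hG.mtrAt_divRicForm hx (chrAt G x Y Z)
  rw [mtrAt_eq_sum b] at hdiv
  simp only [divRicForm_apply] at hdiv
  have hexp : ∑ i, ∑ j, ginv G b x i j * cov₃At G (cov₂At G (ricAt G)) x Y (b i) Z (b j) =
      (∑ i, ∑ j, ginv G b x i j * (fderiv ℝ (cov₂At G (ricAt G)) x Y (b i) Z (b j)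
        - cov₂At G (ricAt G) x (chrAt G x Y (b i)) Z (b j)
        - cov₂At G (ricAt G) x (b i) Z (chrAt G x Y (b j))))
      - ∑ i, ∑ j, ginv G b x i j * cov₂At G (ricAt G) x (b i) (chrAt G x Y Z) (b j) := by
    rw [← Finset.sum_sub_distrib]
    refine Finset.sum_congr rfl fun i _ ↦ ?_
    rw [← Finset.sum_sub_distrib]
    refine Finset.sum_congr rfl fun j _ ↦ ?_
    simp only [cov₃At_apply]
    ring
  rw [hexp, hder, hdiv, hessAt_apply]
  ring

/-- **`Σ_{ij} g^{ij} R(bᵢ, Y) bⱼ = −♯ Ric(Y, ·)`**, paired with the metric: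
`G(Σ g^{ij} R(bᵢ,Y)bⱼ, U) = −Ric(Y, U)` (skew-adjointness of `R` and the trace formula for
`Ric`). [cite: ONeill1983, Ch. 3, Lemma 3.52] -/
theorem IsMetricOn.apply_sum_ginv_riemAt (hG : IsMetricOn G V) (hx : x ∈ V) (Y U : E) :
    G x (∑ i, ∑ j, ginv G b x i j • riemAt G x (b i) Y (b j)) U = -ricAt G x Y U := by
  have hi := hG.isInvertible x hx
  rw [ricAt_eq_sum_ginv b hi]
  simp only [map_sum, map_smul, FunLike.coe_sum, Finset.sum_apply, _root_.smul_apply, smul_eq_mul,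
    ← Finset.sum_neg_distrib]
  refine Finset.sum_congr rfl fun i _ ↦ Finset.sum_congr rfl fun j _ ↦ ?_
  rw [hG.apply_riemAt_swap hx (b i) Y U (b j)]
  ring

/-- **`Σ_{ij} g^{ij} Ric(Z, R(bᵢ,Y)bⱼ) = −Σ_{kl} g^{kl} Ric(Y,b_k) Ric(Z,b_l)`** (`= −⟨Ric(Y), Ric(Z)⟩`,
the term `−2⟨Ric(X),Ric(W)⟩` of Topping 2006, (2.5.4) / `−2 g^{pq} R_{pi} R_{qk}` of Hamilton
1982, Cor. 7.3). [cite: Hamilton1982, Cor. 7.3] -/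
theorem IsMetricOn.sum_ginv_ricAt_riemAt (hG : IsMetricOn G V) (hx : x ∈ V) (Y Z : E) :
    ∑ i, ∑ j, ginv G b x i j * ricAt G x Z (riemAt G x (b i) Y (b j)) =
      -∑ k, ∑ l, ginv G b x k l * (ricAt G x Y (b k) * ricAt G x Z (b l)) := by
  have hi := hG.isInvertible x hx
  set v : E := ∑ i, ∑ j, ginv G b x i j • riemAt G x (b i) Y (b j) with hv
  have hlhs : ∑ i, ∑ j, ginv G b x i j * ricAt G x Z (riemAt G x (b i) Y (b j)) = ricAt G x Z v := by
    simp only [hv, map_sum, map_smul, smul_eq_mul]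
  -- expand `v` in the basis: `bᵏ(v) = Σ_l g^{kl} G(v, b_l) = −Σ_l g^{kl} Ric(Y, b_l)`
  have hcoord : ∀ k, b.coord k v = -∑ l, ginv G b x k l * ricAt G x Y (b l) := by
    intro k
    rw [coord_eq_sum_ginv b hi v k, ← Finset.sum_neg_distrib]
    refine Finset.sum_congr rfl fun l _ ↦ ?_
    rw [hv, hG.apply_sum_ginv_riemAt b hx Y (b l)]
    ring
  have step1 : ricAt G x Z v = ∑ k, b.coord k v * ricAt G x Z (b k) := by
    conv_lhs => rw [← b.sum_repr v]
    simp only [map_sum, map_smul, smul_eq_mul, Basis.coord_apply]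
  rw [hlhs, step1]
  simp only [hcoord, neg_mul, Finset.sum_neg_distrib, Finset.sum_mul, neg_inj]
  rw [Finset.sum_comm]
  refine Finset.sum_congr rfl fun k _ ↦ Finset.sum_congr rfl fun l _ ↦ ?_
  rw [ginv_comm b hi (hG.symm x hx) l k]
  ring

omit [FiniteDimensional ℝ E] [CompleteSpace E] in
/-- Reversal of the indices of a fourfold sum. [folklore] -/
theorem sum_comm₄_rev (f : ι → ι → ι → ι → ℝ) :
    ∑ i, ∑ j, ∑ m, ∑ n, f i j m n = ∑ i, ∑ j, ∑ m, ∑ n, f n m j i := by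
  calc ∑ i, ∑ j, ∑ m, ∑ n, f i j m n = ∑ m, ∑ n, ∑ i, ∑ j, f i j m n := sum_comm_pairs f
    _ = ∑ m, ∑ n, ∑ j, ∑ i, f i j m n :=
        Finset.sum_congr rfl fun m _ ↦ Finset.sum_congr rfl fun n _ ↦ Finset.sum_comm
    _ = ∑ n, ∑ m, ∑ j, ∑ i, f i j m n := Finset.sum_comm

omit [CompleteSpace E] in
/-- The Ricci form applied to a vector expanded in the basis:
`Ric(v, W) = Σ_{mn} g^{mn} G(v, b_n) Ric(b_m, W)`. [folklore] -/
theorem ricAt_eq_sum_ginv_apply (hx : (G x).IsInvertible) (v W : E) :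
    ricAt G x v W = ∑ m, ∑ n, ginv G b x m n * G x v (b n) * ricAt G x (b m) W := by
  conv_lhs => rw [← b.sum_repr v]
  simp only [map_sum, map_smul, FunLike.coe_sum, Finset.sum_apply, _root_.smul_apply, smul_eq_mul,
    ← Basis.coord_apply]
  refine Finset.sum_congr rfl fun m _ ↦ ?_
  rw [coord_eq_sum_ginv b hx v m, Finset.sum_mul]

/-- The curvature contracted against `Ric` through the metric twice,
`Σ_{ij} g^{ij} Ric(R(bᵢ,Y)Z, bⱼ) = Σ_{ijmn} g^{ij} g^{mn} Ric(b_m,bⱼ) Rm(bᵢ,Y,Z,b_n)` with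
`Rm(X,Y,Z,W) = G(R(X,Y)Z,W)`, **is symmetric in `Y, Z`** (pair symmetry and skew-symmetries of
`Rm`, symmetry of `Ric` and of `g^{ij}`); this is the term `2 g^{pr} g^{qs} R_{piqk} R_{rs}` of
Hamilton 1982, Cor. 7.3. [cite: Hamilton1982, Cor. 7.3] -/
theorem IsMetricOn.sum_ginv_ricAt_riemAt_comm (hG : IsMetricOn G V) (hx : x ∈ V) (Y Z : E) :
    ∑ i, ∑ j, ginv G b x i j * ricAt G x (riemAt G x (b i) Y Z) (b j) =
      ∑ i, ∑ j, ginv G b x i j * ricAt G x (riemAt G x (b i) Z Y) (b j) := by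
  have hi := hG.isInvertible x hx
  have hs := hG.symm x hx
  set F : E → E → ι → ι → ι → ι → ℝ := fun Y Z i j m n ↦
    ginv G b x i j * ginv G b x m n * ricAt G x (b m) (b j) * G x (riemAt G x (b i) Y Z) (b n) with hF
  have hexp : ∀ Y Z, ∑ i, ∑ j, ginv G b x i j * ricAt G x (riemAt G x (b i) Y Z) (b j) =
      ∑ i, ∑ j, ∑ m, ∑ n, F Y Z i j m n := by
    intro Y Z
    refine Finset.sum_congr rfl fun i _ ↦ Finset.sum_congr rfl fun j _ ↦ ?_
    rw [ricAt_eq_sum_ginv_apply b hi, Finset.mul_sum]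
    refine Finset.sum_congr rfl fun m _ ↦ ?_
    rw [Finset.mul_sum]
    refine Finset.sum_congr rfl fun n _ ↦ ?_
    simp only [hF]
    ring
  -- `Rm(bᵢ,Z,Y,b_n) = Rm(b_n,Y,Z,bᵢ)`
  have hRm : ∀ i n, G x (riemAt G x (b i) Z Y) (b n) = G x (riemAt G x (b n) Y Z) (b i) := by
    intro i n
    rw [hG.apply_riemAt_pair_comm hx (b i) Z Y (b n), riemAt_swap, _root_.neg_apply, map_neg,
      _root_.neg_apply, hG.apply_riemAt_swap hx (b n) Y Z (b i), neg_neg]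
  have hflip : ∀ i j m n, F Z Y i j m n = F Y Z n m j i := by
    intro i j m n
    simp only [hF, hRm i n, ginv_comm b hi hs j i, ginv_comm b hi hs n m, hG.ricAt_comm hx (b m) (b j)]
    ring
  rw [hexp, hexp, sum_comm₄_rev (F Y Z)]
  exact Finset.sum_congr rfl fun i _ ↦ Finset.sum_congr rfl fun j _ ↦
    Finset.sum_congr rfl fun m _ ↦ Finset.sum_congr rfl fun n _ ↦ (hflip i j m n).symm

omit [CompleteSpace E] in
/-- Exchange of the two factors in a metric contraction: `Σ g^{kl} f_k h_l = Σ g^{kl} h_k f_l`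
(`g^{kl}` symmetric). [folklore] -/
theorem sum_ginv_mul_comm (hx : (G x).IsInvertible) (hs : ∀ v w : E, G x v w = G x w v)
    (f h : ι → ℝ) :
    ∑ k, ∑ l, ginv G b x k l * (f k * h l) = ∑ k, ∑ l, ginv G b x k l * (h k * f l) := by
  rw [Finset.sum_comm]
  refine Finset.sum_congr rfl fun k _ ↦ Finset.sum_congr rfl fun l _ ↦ ?_
  rw [ginv_comm b hx hs l k]
  ring

/-- **`Σ g^{ij} ∇²Ric(bᵢ, Y; Z, bⱼ) = ½ Hess S(Y,Z) − Σ g^{ij} Ric(R(bᵢ,Y)Z, bⱼ) − Σ g^{ij} Ric(Z, R(bᵢ,Y)bⱼ)`**: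
commute the covariant derivatives (the Ricci identity, `cov₃At_cov₂At_comm`) and use
`Σ g^{ij} ∇²Ric(Y, bᵢ; Z, bⱼ) = ½ Hess S(Y,Z)` (Hamilton 1982, proof of Lemma 7.2: "interchanging
the order of derivatives" and the contracted second Bianchi identity). [cite: Hamilton1982, Lemma 7.2] -/
theorem IsMetricOn.sum_ginv_cov₃At_cov₂At_ricAt' (hG : IsMetricOn G V) (hx : x ∈ V) (Y Z : E) :
    ∑ i, ∑ j, ginv G b x i j * cov₃At G (cov₂At G (ricAt G)) x (b i) Y Z (b j) =
      2⁻¹ * hessAt G (scalAt G) x Y Z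
        - ∑ i, ∑ j, ginv G b x i j * ricAt G x (riemAt G x (b i) Y Z) (b j)
        - ∑ i, ∑ j, ginv G b x i j * ricAt G x Z (riemAt G x (b i) Y (b j)) := by
  have hR : ContDiffAt ℝ ∞ (ricAt G) x := hG.contDiffAt_ricAt hx
  rw [← hG.sum_ginv_cov₃At_cov₂At_ricAt b hx Y Z, ← Finset.sum_sub_distrib, ← Finset.sum_sub_distrib]
  refine Finset.sum_congr rfl fun i _ ↦ ?_
  rw [← Finset.sum_sub_distrib, ← Finset.sum_sub_distrib]
  refine Finset.sum_congr rfl fun j _ ↦ ?_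
  linear_combination (ginv G b x i j) * hG.cov₃At_cov₂At_comm hx hR (b i) Y Z (b j)

omit [FiniteDimensional ℝ E] [CompleteSpace E] in
/-- The coordinate Hessian of a smooth function is symmetric: `Hess f (Y,Z) = Hess f (Z,Y)`
(`D²f` symmetric, `Γ` torsion-free). [cite: ONeill1983, Ch. 3, Lemma 3.49] -/
theorem IsMetricOn.hessAt_comm (hG : IsMetricOn G V) (hx : x ∈ V) {f : E → ℝ}
    (hf : ContDiffAt ℝ ∞ f x) (Y Z : E) : hessAt G f x Y Z = hessAt G f x Z Y := by
  simp only [hessAt_apply, hG.chrAt_comm hx Y Z, hf.isSymmSndFDerivAt two_le_infty Y Z]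

end Static

/-! ### The first trace of `∂_t Ric` under the flow -/

/-- The Christoffel variation paired with the metric, as a field of trilinear forms:
`piForm G S t y (X, Y, U) = G_t(Π_t(X,Y), U)` (`Π = ∂_tΓ = varChrAt`). [cite: Topping2006, Prop. 2.3.1] -/
def piForm [CompleteSpace E] (G : ℝ → E → E →L[ℝ] E →L[ℝ] ℝ) (S : Set ℝ) (t : ℝ) (y : E) :
    E →L[ℝ] E →L[ℝ] E →L[ℝ] ℝ :=
  (ContinuousLinearMap.compL ℝ E E (E →L[ℝ] ℝ) (G t y)).comp (varChrAt G S t y)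

/-- Unfolding lemma: `piForm G S t y X Y U = G t y (Π(X,Y)) U`. [folklore] -/
@[simp]
theorem piForm_apply [CompleteSpace E] (G : ℝ → E → E →L[ℝ] E →L[ℝ] ℝ) (S : Set ℝ) (t : ℝ)
    (y X Y U : E) : piForm G S t y X Y U = G t y (varChrAt G S t y X Y) U := rfl

namespace IsMetricFamilyOn

variable {ι : Type*} [Fintype ι] [FiniteDimensional ℝ E] [CompleteSpace E]
  {G : ℝ → E → E →L[ℝ] E →L[ℝ] ℝ} {S : Set ℝ} {V : Set E} {x : E} {t : ℝ} (b : Basis ι ℝ E)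

omit [Fintype ι] [FiniteDimensional ℝ E] in
/-- **Lowering commutes with `∇` for `Π`**: `G((∇_WΠ)(Y,Z), U) = (∇_W piForm)(Y,Z,U)`, where
`(∇_WΠ)(Y,Z) = D_WΠ(Y,Z) + Γ_W Π(Y,Z) − Π(Γ_W Y, Z) − Π(Y, Γ_W Z)` (metric compatibility
`∂_W G = G(Γ_W·,·) + G(·,Γ_W·)`). [cite: ONeill1983, Ch. 3, p. 86] -/
theorem apply_cov_varChrAt (hG : IsMetricFamilyOn G S V) (hx : x ∈ V) (ht : t ∈ S) (W Y Z U : E) :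
    G t x (fderiv ℝ (varChrAt G S t) x W Y Z) U + G t x (chrAt (G t) x W (varChrAt G S t x Y Z)) U
      - G t x (varChrAt G S t x (chrAt (G t) x W Y) Z) U
      - G t x (varChrAt G S t x Y (chrAt (G t) x W Z)) U =
      cov₃At (G t) (piForm G S t) x W Y Z U := by
  have hGt := hG.isMetricOn t ht
  have hPd := hG.differentiableAt_varChrAt hx ht
  have hGd := hGt.differentiableAt hx
  -- `piForm` is differentiable, and its derivative evaluated is that of `y ↦ G y (Π y Y Z) U`
  have hπd : DifferentiableAt ℝ (piForm G S t) x :=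
    ((ContinuousLinearMap.compL ℝ E E (E →L[ℝ] ℝ)).differentiableAt.comp x hGd).clm_comp hPd
  have hev : fderiv ℝ (piForm G S t) x W Y Z U =
      fderiv ℝ (fun y ↦ G t y (varChrAt G S t y Y Z) U) x W := by
    rw [← fderiv_clm_apply_const hπd Y W,
      ← fderiv_clm_apply_const (differentiableAt_clm_apply_const hπd Y) Z W,
      ← fderiv_clm_apply_const (differentiableAt_clm_apply_const
        (differentiableAt_clm_apply_const hπd Y) Z) U W]
    rfl
  -- product rule for `y ↦ G y (c y) U`, `c y = Π_y(Y,Z)`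
  have hc : HasFDerivAt (fun y ↦ varChrAt G S t y Y Z) (((fderiv ℝ (varChrAt G S t) x).flip Y).flip Z) x :=
    hasFDerivAt_clm_apply_const (hasFDerivAt_clm_apply_const hPd.hasFDerivAt Y) Z
  have hprod := hasFDerivAt_clm_apply_const (hGd.hasFDerivAt.clm_apply hc) U
  have hval : fderiv ℝ (fun y ↦ G t y (varChrAt G S t y Y Z) U) x W =
      G t x (fderiv ℝ (varChrAt G S t) x W Y Z) U + fderiv ℝ (G t) x W (varChrAt G S t x Y Z) U := by
    rw [hprod.fderiv]
    rfl
  rw [cov₃At_apply, hev, hval, hGt.fderiv_eq_chrAt hx W (varChrAt G S t x Y Z) U]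
  simp only [piForm_apply]
  ring

/-- **The first trace through the metric**: `Σᵢ bⁱ((∇_{bᵢ}Π)(Y,Z)) = Σ_{ij} g^{ij} (∇_{bᵢ} piForm)(Y,Z,bⱼ)`.
[folklore] -/
theorem sum_coord_cov_varChrAt (hG : IsMetricFamilyOn G S V) (hx : x ∈ V) (ht : t ∈ S) (Y Z : E) :
    ∑ i, b.coord i (fderiv ℝ (varChrAt G S t) x (b i) Y Z
      + chrAt (G t) x (b i) (varChrAt G S t x Y Z)
      - varChrAt G S t x (chrAt (G t) x (b i) Y) Z
      - varChrAt G S t x Y (chrAt (G t) x (b i) Z)) =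
      ∑ i, ∑ j, ginv (G t) b x i j * cov₃At (G t) (piForm G S t) x (b i) Y Z (b j) := by
  have hi := (hG.isMetricOn t ht).isInvertible x hx
  refine Finset.sum_congr rfl fun i _ ↦ ?_
  rw [coord_eq_sum_ginv b hi]
  refine Finset.sum_congr rfl fun j _ ↦ ?_
  rw [← hG.apply_cov_varChrAt hx ht]
  simp only [map_add, map_sub, _root_.add_apply, _root_.sub_apply]

section RicciFlow

variable (hG : IsMetricFamilyOn G S V)
  (hfl : ∀ s ∈ S, ∀ y ∈ V, tDeriv G S s y = (-2 : ℝ) • ricAt (G s) y)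
include hG hfl

omit [Fintype ι] in
/-- **`piForm` under the flow** (Prop. 2.3.1 with `h = −2Ric`): near `x`,
`G(Π(X,Y),U) = −[(∇Ric)(X;Y,U) + (∇Ric)(Y;X,U) − (∇Ric)(U;X,Y)]`, as an identity of fields of
trilinear forms. [cite: Topping2006, Prop. 2.3.1] -/
theorem piForm_eventuallyEq (hx : x ∈ V) (ht : t ∈ S) :
    piForm G S t =ᶠ[𝓝 x] fun y ↦ -(cov₂At (G t) (ricAt (G t)) y
      + swap₁₂ (cov₂At (G t) (ricAt (G t)) y)
      - swap₂₃ (swap₁₂ (cov₂At (G t) (ricAt (G t)) y))) := by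
  filter_upwards [(hG.isOpen ht).mem_nhds hx] with y hy
  ext X Y U
  simp only [piForm_apply, hG.apply_varChrAt_of_flow hfl ht hy, _root_.neg_apply, _root_.sub_apply,
    _root_.add_apply, swap₁₂_apply, swap₂₃_apply]

omit [Fintype ι] in
/-- **`∇ piForm` under the flow**:
`(∇_W piForm)(Y,Z,U) = −[∇²Ric(W,Y;Z,U) + ∇²Ric(W,Z;Y,U) − ∇²Ric(W,U;Y,Z)]`.
[cite: Topping2006, Prop. 2.3.1] -/
theorem cov₃At_piForm (hx : x ∈ V) (ht : t ∈ S) (W Y Z U : E) :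
    cov₃At (G t) (piForm G S t) x W Y Z U =
      -(cov₃At (G t) (cov₂At (G t) (ricAt (G t))) x W Y Z U
        + cov₃At (G t) (cov₂At (G t) (ricAt (G t))) x W Z Y U
        - cov₃At (G t) (cov₂At (G t) (ricAt (G t))) x W U Y Z) := by
  have hGt := hG.isMetricOn t ht
  set C := cov₂At (G t) (ricAt (G t)) with hC
  have hCd : DifferentiableAt ℝ C x :=
    (hGt.contDiffAt_cov₂At hx hGt.contDiffOn_ricAt).differentiableAt (by simp)
  set T₁ := (swap₁₂ : (E →L[ℝ] E →L[ℝ] E →L[ℝ] ℝ) →L[ℝ] (E →L[ℝ] E →L[ℝ] E →L[ℝ] ℝ)) with hT₁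
  set T₂ := (swap₂₃ : (E →L[ℝ] E →L[ℝ] E →L[ℝ] ℝ) →L[ℝ] (E →L[ℝ] E →L[ℝ] E →L[ℝ] ℝ)) with hT₂
  have h1 : HasFDerivAt (fun y ↦ T₁ (C y)) (T₁.comp (fderiv ℝ C x)) x :=
    (T₁.hasFDerivAt.comp x hCd.hasFDerivAt :)
  have h2 : HasFDerivAt (fun y ↦ T₂ (T₁ (C y))) (T₂.comp (T₁.comp (fderiv ℝ C x))) x :=
    (T₂.hasFDerivAt.comp x h1 :)
  have hlam : HasFDerivAt (fun y ↦ -(C y + T₁ (C y) - T₂ (T₁ (C y))))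
      (-(fderiv ℝ C x + T₁.comp (fderiv ℝ C x) - T₂.comp (T₁.comp (fderiv ℝ C x)))) x :=
    ((hCd.hasFDerivAt.add h1).sub h2).neg
  -- the derivative of `piForm` at `x` is that of the right-hand side of Prop. 2.3.1
  have hD : fderiv ℝ (piForm G S t) x =
      -(fderiv ℝ C x + T₁.comp (fderiv ℝ C x) - T₂.comp (T₁.comp (fderiv ℝ C x))) := by
    rw [(hG.piForm_eventuallyEq hfl hx ht).fderiv_eq]
    exact hlam.fderiv
  -- the values of `piForm` at `x`
  have hval : ∀ X' Y' U', piForm G S t x X' Y' U' = -(C x X' Y' U' + C x Y' X' U' - C x U' X' Y') :=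
    fun X' Y' U' ↦ by rw [piForm_apply, hG.apply_varChrAt_of_flow hfl ht hx]
  simp only [cov₃At_apply, hD, hval, hT₁, hT₂, _root_.neg_apply, _root_.add_apply, _root_.sub_apply,
    ContinuousLinearMap.comp_apply, swap₁₂_apply, swap₂₃_apply]
  ring

/-- **The first trace of `∂_t Ric` under the flow**:
`Σᵢ bⁱ((∇_{bᵢ}Π)(Y,Z)) = ΔRic(Y,Z) − Σ g^{ij} ∇²Ric(bᵢ,Y;Z,bⱼ) − Σ g^{ij} ∇²Ric(bᵢ,Z;Y,bⱼ)`
(Prop. 2.3.1 under the flow, lowered and traced). [cite: Topping2006, Prop. 2.3.7] -/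
theorem termI_eq (hx : x ∈ V) (ht : t ∈ S) (Y Z : E) :
    ∑ i, b.coord i (fderiv ℝ (varChrAt G S t) x (b i) Y Z
      + chrAt (G t) x (b i) (varChrAt G S t x Y Z)
      - varChrAt G S t x (chrAt (G t) x (b i) Y) Z
      - varChrAt G S t x Y (chrAt (G t) x (b i) Z)) =
      lapBilinAt (G t) (ricAt (G t)) x Y Z
        - ∑ i, ∑ j, ginv (G t) b x i j * cov₃At (G t) (cov₂At (G t) (ricAt (G t))) x (b i) Y Z (b j)
        - ∑ i, ∑ j, ginv (G t) b x i j * cov₃At (G t) (cov₂At (G t) (ricAt (G t))) x (b i) Z Y (b j) := by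
  rw [hG.sum_coord_cov_varChrAt b hx ht, lapBilinAt_apply_eq_sum (G t) (ricAt (G t)) b]
  simp only [hG.cov₃At_piForm hfl hx ht, mul_neg, mul_add, mul_sub, Finset.sum_neg_distrib,
    Finset.sum_add_distrib, Finset.sum_sub_distrib]
  ring

/-- **The second trace of `∂_t Ric` is `−Hess S` under the flow**:
`Σᵢ bⁱ((∇_YΠ)(bᵢ,Z)) = −Hess S(Y,Z)` (`trₓ Π(·,Z) = −dS(Z)` and the trace of the commutator
`[Γ_Y, Π(·,Z)]` vanishes; Topping 2006, (2.3.16)). [cite: Topping2006, Prop. 2.3.7] -/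
theorem termII_eq (hx : x ∈ V) (ht : t ∈ S) (Y Z : E) :
    ∑ i, b.coord i (fderiv ℝ (varChrAt G S t) x Y (b i) Z
      + chrAt (G t) x Y (varChrAt G S t x (b i) Z)
      - varChrAt G S t x (chrAt (G t) x Y (b i)) Z
      - varChrAt G S t x (b i) (chrAt (G t) x Y Z)) = -hessAt (G t) (scalAt (G t)) x Y Z := by
  have hGt := hG.isMetricOn t ht
  have hPd := hG.differentiableAt_varChrAt hx ht
  have hSc : ContDiffAt ℝ ∞ (scalAt (G t)) x := hGt.contDiffAt_scalAt hx
  have hdS : DifferentiableAt ℝ (fderiv ℝ (scalAt (G t))) x :=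
    (hSc.fderiv_right (m := ∞) (by simp)).differentiableAt (by simp)
  -- `ω(y)(Z) = Σᵢ bⁱ(Π_y(bᵢ, Z)) = −dS_y(Z)` near `x`
  have hω : (fun y ↦ ∑ i, b.coord i (varChrAt G S t y (b i) Z)) =ᶠ[𝓝 x]
      fun y ↦ -fderiv ℝ (scalAt (G t)) y Z := by
    filter_upwards [(hG.isOpen ht).mem_nhds hx] with y hy
    exact hG.sum_coord_varChrAt_eq b hfl ht hy Z
  -- (1) `Σᵢ bⁱ(D_YΠ(bᵢ,Z)) = ∂_Y ω(·)(Z) = −D²S(Y, Z)`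
  have h1 : ∑ i, b.coord i (fderiv ℝ (varChrAt G S t) x Y (b i) Z) =
      -fderiv ℝ (fderiv ℝ (scalAt (G t))) x Y Z := by
    have hdiff : ∀ i, DifferentiableAt ℝ (fun y ↦ varChrAt G S t y (b i) Z) x := fun i ↦
      differentiableAt_clm_apply_const (differentiableAt_clm_apply_const hPd (b i)) Z
    have hsum : fderiv ℝ (fun y ↦ ∑ i, b.coord i (varChrAt G S t y (b i) Z)) x Y =
        ∑ i, b.coord i (fderiv ℝ (varChrAt G S t) x Y (b i) Z) := by
      have hs : HasFDerivAt (fun y ↦ ∑ i, coordCLM b i (varChrAt G S t y (b i) Z))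
          (∑ i, (coordCLM b i).comp (fderiv ℝ (fun y ↦ varChrAt G S t y (b i) Z) x)) x :=
        HasFDerivAt.fun_sum fun i _ ↦ (coordCLM b i).hasFDerivAt.comp x (hdiff i).hasFDerivAt
      simp only [coordCLM_apply] at hs
      rw [hs.fderiv, FunLike.coe_sum, Finset.sum_apply]
      refine Finset.sum_congr rfl fun i _ ↦ ?_
      rw [ContinuousLinearMap.comp_apply, coordCLM_apply,
        fderiv_clm_apply_const (differentiableAt_clm_apply_const hPd (b i)) Z Y,
        fderiv_clm_apply_const hPd (b i) Y]
    rw [← hsum, hω.fderiv_eq, fderiv_fun_neg, _root_.neg_apply, fderiv_clm_apply_const hdS Z Y]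
  -- (2) the trace of the commutator `[Γ_Y, Π(·,Z)]` vanishes
  have h2 : ∑ i, b.coord i (chrAt (G t) x Y (varChrAt G S t x (b i) Z)) =
      ∑ i, b.coord i (varChrAt G S t x (chrAt (G t) x Y (b i)) Z) :=
    sum_coord_comp_comm b (chrAt (G t) x Y) ((varChrAt G S t x).flip Z)
  -- (3) `Σᵢ bⁱ(Π(bᵢ, Γ(Y,Z))) = −dS(Γ(Y,Z))`
  have h3 : ∑ i, b.coord i (varChrAt G S t x (b i) (chrAt (G t) x Y Z)) =
      -fderiv ℝ (scalAt (G t)) x (chrAt (G t) x Y Z) :=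
    hG.sum_coord_varChrAt_eq b hfl ht hx _
  simp only [map_add, map_sub, Finset.sum_add_distrib, Finset.sum_sub_distrib, h1, h2, h3, hessAt_apply]
  ring

/-- **Evolution of the Ricci tensor under the Ricci flow, in coordinates** (Hamilton 1982,
Cor. 7.3; Topping 2006, Prop. 2.5.3), symmetrized form. Let `G` be a smooth one-parameter
family of metric components on `V × S` satisfying `∂G/∂t = −2 Ric(G)` on `V × S`. Then at every
`t ∈ S`, `x ∈ V`, for all `Y Z : E` and in any basis `b` (inverse metric coefficients `g^{ij}`),
`s ↦ Ric(G s)_x(Y,Z)` has derivative within `S`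

`ΔRic(Y,Z) + Σ_{ij} g^{ij} [Ric(R(bᵢ,Y)Z, bⱼ) + Ric(R(bᵢ,Z)Y, bⱼ) + Ric(Z, R(bᵢ,Y)bⱼ) + Ric(Y, R(bᵢ,Z)bⱼ)]`

(`Δ = lapBilinAt`, the rough Laplacian; `R = riemAt`). See `hasDerivWithinAt_ricAt_ricciFlow'`
for the printed form. [cite: Hamilton1982, Cor. 7.3] -/
theorem hasDerivWithinAt_ricAt_ricciFlow (hx : x ∈ V) (ht : t ∈ S) (Y Z : E) :
    HasDerivWithinAt (fun s ↦ ricAt (G s) x Y Z)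
      (lapBilinAt (G t) (ricAt (G t)) x Y Z
        + ∑ i, ∑ j, ginv (G t) b x i j * (ricAt (G t) x (riemAt (G t) x (b i) Y Z) (b j)
          + ricAt (G t) x (riemAt (G t) x (b i) Z Y) (b j)
          + ricAt (G t) x Z (riemAt (G t) x (b i) Y (b j))
          + ricAt (G t) x Y (riemAt (G t) x (b i) Z (b j)))) S t := by
  have hGt := hG.isMetricOn t ht
  have hd := hG.hasDerivWithinAt_ricAt_apply b hx ht Y Z
  refine hd.congr_deriv ?_
  have hc := hGt.chrAt_comm hx
  -- split `Σᵢ bⁱ(∂_t R(bᵢ,Y)Z)` into the two traces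
  have hsplit : ∑ i, b.coord i (varRiemAt G S t x (b i) Y Z) =
      (∑ i, b.coord i (fderiv ℝ (varChrAt G S t) x (b i) Y Z
        + chrAt (G t) x (b i) (varChrAt G S t x Y Z)
        - varChrAt G S t x (chrAt (G t) x (b i) Y) Z
        - varChrAt G S t x Y (chrAt (G t) x (b i) Z)))
      - ∑ i, b.coord i (fderiv ℝ (varChrAt G S t) x Y (b i) Z
        + chrAt (G t) x Y (varChrAt G S t x (b i) Z)
        - varChrAt G S t x (chrAt (G t) x Y (b i)) Z
        - varChrAt G S t x (b i) (chrAt (G t) x Y Z)) := by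
    rw [← Finset.sum_sub_distrib]
    refine Finset.sum_congr rfl fun i _ ↦ ?_
    rw [← map_sub]
    congr 1
    simp only [varRiemAt_apply, hc (b i) Y]
    abel
  rw [hsplit, hG.termI_eq b hfl hx ht, hG.termII_eq b hfl hx ht,
    hGt.sum_ginv_cov₃At_cov₂At_ricAt' b hx Y Z, hGt.sum_ginv_cov₃At_cov₂At_ricAt' b hx Z Y,
    hGt.hessAt_comm hx (hGt.contDiffAt_scalAt hx) Z Y]
  simp only [mul_add, Finset.sum_add_distrib]
  ring

/-- **Hamilton 1982, Cor. 7.3 / Topping 2006, Prop. 2.5.3 (evolution of the Ricci tensor under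
the Ricci flow), in coordinates, printed form.** Under `∂G/∂t = −2 Ric(G)` on `V × S`, at
`t ∈ S`, `x ∈ V`, for `Y Z : E` and any basis `b`:

`∂_t Ric(Y,Z) = ΔRic(Y,Z) + 2 Σ_{ij} g^{ij} Ric(R(bᵢ,Y)Z, bⱼ) − 2 Σ_{kl} g^{kl} Ric(Y,b_k) Ric(Z,b_l)`,

i.e. `∂_t R_{ik} = ΔR_{ik} + 2 g^{pr}g^{qs} R_{piqk} R_{rs} − 2 g^{pq} R_{pi} R_{qk}` (Hamilton, with
`R_{piqk} = G(R(∂_p,∂_i)∂_q, ∂_k)` in the convention `R(X,Y) = [∇_X,∇_Y]` of `riemAt`, for which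
`Ric_{ik} = R^p{}_{pik}`), Topping's `∂_t Ric(X,W) = ΔRic(X,W) + 2⟨Rm(X,·,W,·),Ric⟩ − 2⟨Ric(X),Ric(W)⟩`
((2.5.4), `= Δ_L Ric`). The derivative is within `S` (valid up to the end points of a closed
time interval). [cite: Hamilton1982, Cor. 7.3] -/
theorem hasDerivWithinAt_ricAt_ricciFlow' (hx : x ∈ V) (ht : t ∈ S) (Y Z : E) :
    HasDerivWithinAt (fun s ↦ ricAt (G s) x Y Z)
      (lapBilinAt (G t) (ricAt (G t)) x Y Z
        + 2 * ∑ i, ∑ j, ginv (G t) b x i j * ricAt (G t) x (riemAt (G t) x (b i) Y Z) (b j)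
        - 2 * ∑ k, ∑ l, ginv (G t) b x k l * (ricAt (G t) x Y (b k) * ricAt (G t) x Z (b l))) S t := by
  have hGt := hG.isMetricOn t ht
  have hi := hGt.isInvertible x hx
  refine (hG.hasDerivWithinAt_ricAt_ricciFlow b hfl hx ht Y Z).congr_deriv ?_
  simp only [mul_add, Finset.sum_add_distrib]
  rw [← hGt.sum_ginv_ricAt_riemAt_comm b hx Y Z, hGt.sum_ginv_ricAt_riemAt b hx Y Z,
    hGt.sum_ginv_ricAt_riemAt b hx Z Y,
    sum_ginv_mul_comm b hi (hGt.symm x hx) (fun k ↦ ricAt (G t) x Z (b k)) (fun l ↦ ricAt (G t) x Y (b l))]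
  ring

end RicciFlow

end IsMetricFamilyOn

end MetricCoord

end Literature.Geometry.Lorentzian

end
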